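import Summits.BirchSwinnertonDyer.BirchSwinnertonDyer.Theorems.AlignedTransportAtTwoMainConjectureOfRankZeroBSDAtTwoFineRoadInfResSurj
import Literature.NumberTheory.EllipticCurves.H1CorestrictionIndexTwo
import Literature.NumberTheory.EllipticCurves.IwasawaSelmerProofs
import HarnessLib

/-!
# Route `GenusKolyvaginAtTwo`, LINE 6, KEY crux Q3 `EquivariantKolyvaginExactAtTwo`
# (stmt-BirchSwinnertonDyer-24882): INFLATION–RESTRICTION IN THE ABSOLUTE MODEL AND ITS TWIST SIDE —
# `H¹(G, M') ≅ H¹(N, M)^{c = −1}` for `M' = M ⊗ χ`, and the SHARP index-`2` descent (generic, PROVED)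

Helper (seat `bsd-line-gk2-p3` g10, cell `bsd-f1-sign2`; `--supports` the item, closes nothing), the
GENERIC half of stub S1(−) of the eigen/`ℚ_ℓ` architecture for Q3 (memo Q3-ARCH v2, evidence #6 on
the item; companion file `…EquivariantKolyvaginExactAtTwoQuadInfResTwist` instantiates it for
`E/ℚ`, `K` quadratic, `M = E[p^∞]`, `M' = E^{(c)}[p^∞]`).

Setting: a topological group `G`, an open normal subgroup `N` of index `2` with `G = N ⊔ N c`
(`Xor (b c⁻¹ ∈ N) (b ∈ N)`, the tree's `xor_galRange` shape), discrete `G`-modules `M`, `M'` with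
continuous orbit maps, an additive `ψ : M' ≃ M` that is `N`-equivariant and ANTI-equivariant at `c`
(`ψ (c m') = −c ψ(m')` — the twist by the character of `G/N`; the tree's `psiQ_smul_liftToAbsGal`
for `E^{(c)}[p^∞] ≅ E[p^∞]`), and `M^{N} = 0`. Cohomology is the tree's continuous `H¹`
(`discreteH1 G M = H¹(G, M)`, `subgroupH1 N M = H¹(N, M)`, restriction `resSubgroupH1 N M`,
conjugation `conjH1 N M g`, coefficient isomorphism `h1Equiv ψ`).

* §0 `resSubgroupH1_top_bijective`, `resSubgroupH1_eq_resOfLe_comp_top` — `H¹(G, M) ≅ H¹(⊤, M)`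
  and `res_{G→N} = res_{⊤→N} ∘ res_{G→⊤}`: the bookkeeping that moves att-p4 g3's generic
  inflation–restriction theorems (`InfResSharp.resOfLe_injective_of_fixedPoints_eq_bot`,
  `InfResSurj.exists_resOfLe_eq_of_forall_conjH1_eq`, stated between SUBGROUPS `H₁ ≤ H₂`) to the
  ABSOLUTE model `H¹(G, ·) → H¹(N, ·)` in which `galH1Primary`, `resPrimary`, `modelIso` live:
  `resSubgroupH1_injective_of_fixedPoints_eq_bot`, `mem_range_resSubgroupH1_iff_forall_conjH1_eq`
  (**`H¹(G, M) ≅ H¹(N, M)^{G}`** when `M^{N} = 0`).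
* §1 (index `2`) `forall_conjH1_eq_iff_of_xor` (invariance under all of `G` = under `conj_c`),
  `conjH1_conjH1_of_mul_self_mem` (`conj_c² = id`), `mem_range_resSubgroupH1_iff_conjH1_eq`
  (**`+` side: `res H¹(G, M) = H¹(N, M)^{c = +1}`**), and the MAIN THEOREM
  `exists_h1Equiv_resSubgroupH1_eq_iff` (**`−` side: `ψ_* res' H¹(G, M') = H¹(N, M)^{c = −1}`**,
  from the tree's `h1Equiv_conjH1_neg`), with injectivity `h1Equiv_resSubgroupH1_injective`; then
  the SHARP descent: `ξ + cξ ∈ res H¹(G, M)` (`add_conjH1_mem_range_resSubgroupH1`),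
  `ξ − cξ ∈ ψ_* res' H¹(G, M')` (`exists_h1Equiv_resSubgroupH1_eq_sub_conjH1`),
  **`2 H¹(N, M) ⊆ res H¹(G,M) + ψ_* res' H¹(G,M')`** (`two_nsmul_mem_sup_range`) and
  **`res η + ψ_* res' η' = 0 ⟹ 2η = 0 ∧ 2η' = 0`** (`two_nsmul_eq_zero_of_add_eq_zero`) — exponent
  `1` on both sides, where the tree's `IndexTwoDecompositionData` (built for Selmer groups, with an
  archimedean defect `a`) gives `4` and `2^{a+1}`.

Everything is PROVED from tree theorems (no named fact, no definition, no `sorry`, standard axioms).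
BSD is not proved by any of this.

References: [SerreGaloisCohomology1997] I §2.4, §2.6 (b); [SerreLocalFields1979] VII §5 Prop. 3;
[NeukirchSchmidtWingberg2008] I §6 Prop. 1.6.7; [DokchitserDokchitserAnnals2010] Lemma 4.14 (proof);
[Dokchitser2013ParityNotes] §4 (the twist `E_α ≅ E` over `K(√α)`).
-/

set_option autoImplicit false
set_option linter.dupNamespace false -- tree convention: `Summit.BirchSwinnertonDyer.BirchSwinnertonDyer.Theorems` (summit = sub-problem)

noncomputable section

namespace Summit.BirchSwinnertonDyer.BirchSwinnertonDyer.Theorems.GenusExact.TwistInfRes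

open Literature.NumberTheory.EllipticCurves
open Summit.BirchSwinnertonDyer.BirchSwinnertonDyer.Theorems.AlignedTransportAtTwoFineRoad

universe u

/-! ## §0 The absolute model `H¹(G, M)` versus the subgroup model `H¹(⊤, M)` -/

section Generic

variable {G : Type u} [Group G] [TopologicalSpace G] [IsTopologicalGroup G]
  {M : Type u} [AddCommGroup M] [DistribMulAction G M] [TopologicalSpace M] [DiscreteTopology M]

/-- **`H¹(G, M) ≅ H¹(⊤, M)`**: restriction from `G` to its top subgroup (`resSubgroupH1 ⊤`, the map
of the pair `(⊤ ↪ G, id_M)`) is a bijection, with inverse the map of the pair `(G ≃ ⊤, id_M)`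
(functoriality `resH1Hom_comp`, `resH1Hom_id`). This is the bookkeeping that lets the intrinsic
model `galH1Primary W p = H¹(Γ_K, E[p^∞])` use the inflation–restriction theorems stated for the
subgroup model `subgroupH1 ⊤`. [cite: SerreGaloisCohomology1997, I §2.4] -/
theorem resSubgroupH1_top_bijective :
    Function.Bijective (resSubgroupH1 (⊤ : Subgroup G) M) := by
  let φ : G →ₜ* (⊤ : Subgroup G) :=
    { toFun := fun g ↦ ⟨g, Subgroup.mem_top g⟩
      map_one' := rfl
      map_mul' := fun _ _ ↦ rfl
      continuous_toFun := continuous_id.subtype_mk _ }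
  let ι : subgroupH1 (⊤ : Subgroup G) M →+ discreteH1 G M :=
    resH1Hom φ (AddMonoidHom.id M) (fun _ _ ↦ rfl)
  have h1 : ∀ c, ι (resSubgroupH1 (⊤ : Subgroup G) M c) = c := fun c ↦ by
    change resH1Hom φ (AddMonoidHom.id M) (fun _ _ ↦ rfl)
      (resH1Hom (subgroupIncl (⊤ : Subgroup G)) (AddMonoidHom.id M) (fun _ _ ↦ rfl) c) = c
    rw [resH1Hom_resH1Hom]
    have e : resH1Hom ((subgroupIncl (⊤ : Subgroup G)).comp φ)
        ((AddMonoidHom.id M).comp (AddMonoidHom.id M)) (fun _ _ ↦ rfl) =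
          resH1Hom (ContinuousMonoidHom.id G) (AddMonoidHom.id M) (fun _ _ ↦ rfl) :=
      resH1Hom_congr (by ext; rfl) (by ext; rfl) _ _
    rw [e, resH1Hom_id]
    rfl
  have h2 : ∀ c, resSubgroupH1 (⊤ : Subgroup G) M (ι c) = c := fun c ↦ by
    change resH1Hom (subgroupIncl (⊤ : Subgroup G)) (AddMonoidHom.id M) (fun _ _ ↦ rfl)
      (resH1Hom φ (AddMonoidHom.id M) (fun _ _ ↦ rfl) c) = c
    rw [resH1Hom_resH1Hom]
    have e : resH1Hom (φ.comp (subgroupIncl (⊤ : Subgroup G)))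
        ((AddMonoidHom.id M).comp (AddMonoidHom.id M)) (fun _ _ ↦ rfl) =
          resH1Hom (ContinuousMonoidHom.id (⊤ : Subgroup G)) (AddMonoidHom.id M) (fun _ _ ↦ rfl) :=
      resH1Hom_congr (by ext; rfl) (by ext; rfl) _ _
    rw [e, resH1Hom_id]
    rfl
  exact Function.bijective_iff_has_inverse.2 ⟨ι, h1, h2⟩

/-- **Restriction to a subgroup factors through the top subgroup**:
`res_{G → N} = res_{⊤ → N} ∘ res_{G → ⊤}` (functoriality of `H¹_cont` in compatible pairs).
[cite: SerreGaloisCohomology1997, I §2.4] -/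
theorem resSubgroupH1_eq_resOfLe_comp_top (N : Subgroup G) :
    resSubgroupH1 N M = (Literature.NumberTheory.EllipticCurves.resOfLe M (le_top : N ≤ ⊤)).comp
      (resSubgroupH1 (⊤ : Subgroup G) M) := by
  rw [resSubgroupH1, resSubgroupH1, Literature.NumberTheory.EllipticCurves.resOfLe, resH1Hom_comp]
  exact resH1Hom_congr (ContinuousMonoidHom.ext fun _ ↦ rfl) (AddMonoidHom.ext fun _ ↦ rfl) _ _

/-- **Inflation–restriction, injective form, absolute model**: for a normal subgroup `N ≤ G` and a
discrete `G`-module `M` with continuous orbit maps and `M^{N} = 0`, the restriction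
`res : H¹(G, M) → H¹(N, M)` is INJECTIVE (att-p4's `InfResSharp.resOfLe_injective_of_fixedPoints_eq_bot`
transported along §0). [cite: SerreGaloisCohomology1997, I §2.6 (inflation–restriction)] -/
theorem resSubgroupH1_injective_of_fixedPoints_eq_bot (N : Subgroup G) [hN : N.Normal]
    (hcont : ∀ m : M, Continuous fun g : G ↦ g • m)
    (hfix : FixedPoints.addSubgroup N M = ⊥) :
    Function.Injective (resSubgroupH1 N M) := by
  rw [resSubgroupH1_eq_resOfLe_comp_top N, AddMonoidHom.coe_comp]
  exact (InfResSharp.resOfLe_injective_of_fixedPoints_eq_bot (M := M) (le_top : N ≤ ⊤)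
    (fun g _ h hh ↦ hN.conj_mem' h hh g) hcont hfix).comp resSubgroupH1_top_bijective.injective

/-- **Inflation–restriction, image form, absolute model**: for an OPEN normal subgroup `N ≤ G` and a
discrete `G`-module `M` with continuous orbit maps and `M^{N} = 0`, a class of `H¹(N, M)` is a
restriction from `G` iff it is fixed by every conjugation `conj_g`, `g ∈ G` (att-p4's
`InfResSurj.exists_resOfLe_eq_of_forall_conjH1_eq` transported along §0; the converse is
`conjH1_resSubgroupH1`). With the previous theorem: **`H¹(G, M) ≅ H¹(N, M)^{G/N}`**.
[cite: SerreGaloisCohomology1997, I §2.6 (b)] [cite: NeukirchSchmidtWingberg2008, I.§6 Prop. 1.6.7] -/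
theorem mem_range_resSubgroupH1_iff_forall_conjH1_eq (N : Subgroup G) [hN : N.Normal]
    (hopen : IsOpen (N : Set G)) (hcont : ∀ m : M, Continuous fun g : G ↦ g • m)
    (hfix : FixedPoints.addSubgroup N M = ⊥) (c : subgroupH1 N M) :
    c ∈ (resSubgroupH1 N M).range ↔ ∀ g : G, conjH1 N M g c = c := by
  constructor
  · rintro ⟨c', rfl⟩ g
    exact conjH1_resSubgroupH1 N hcont g c'
  · intro hc
    have hopen' : IsOpen ((N.subgroupOf ⊤ : Subgroup (⊤ : Subgroup G)) : Set (⊤ : Subgroup G)) := by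
      rw [Subgroup.coe_subgroupOf]
      exact hopen.preimage continuous_subtype_val
    obtain ⟨c', hc'⟩ := InfResSurj.exists_resOfLe_eq_of_forall_conjH1_eq (M := M)
      (le_top : N ≤ ⊤) hfix hopen' c (fun g _ ↦ hc g)
    obtain ⟨c'', rfl⟩ := resSubgroupH1_top_bijective.surjective c'
    exact ⟨c'', by rw [resSubgroupH1_eq_resOfLe_comp_top N, AddMonoidHom.comp_apply, hc']⟩

end Generic

/-! ## §1 Index two: the twisted module and the SHARP `±` descent (generic) -/

section Twist

variable {G : Type u} [Group G] [TopologicalSpace G] [IsTopologicalGroup G]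
  {N : Subgroup G} [hN : N.Normal] {c : G}
  {M : Type u} [AddCommGroup M] [DistribMulAction G M] [TopologicalSpace M] [DiscreteTopology M]
  {M' : Type u} [AddCommGroup M'] [DistribMulAction G M'] [TopologicalSpace M']
  [DiscreteTopology M']

omit [TopologicalSpace G] [IsTopologicalGroup G] hN [TopologicalSpace M] [DiscreteTopology M]
  [TopologicalSpace M'] [DiscreteTopology M'] in
/-- `N`-fixed points transport along an `N`-equivariant additive isomorphism `ψ : M' ≃ M`:
`M^{N} = 0 ⟹ M'^{N} = 0` (for the twist `E^{(c)}[p^∞] ≅ E[p^∞]` over `K`: `E(K)[p] = 0` iff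
`E^{(c)}(K)[p] = 0`). [folklore] -/
theorem fixedPoints_eq_bot_of_equivariant_equiv (ψ : M' ≃+ M)
    (hψ : ∀ (n : N) (m' : M'), ψ (n • m') = n • ψ m')
    (hfix : FixedPoints.addSubgroup N M = ⊥) : FixedPoints.addSubgroup N M' = ⊥ := by
  rw [eq_bot_iff]
  intro m' hm'
  rw [AddSubgroup.mem_bot]
  have h : ψ m' ∈ FixedPoints.addSubgroup N M :=
    (FixedPoints.mem_addSubgroup N M _).2 fun n ↦ by
      rw [← hψ, (FixedPoints.mem_addSubgroup N M' _).1 hm' n]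
  rw [hfix, AddSubgroup.mem_bot] at h
  exact (map_eq_zero_iff ψ ψ.injective).1 h

/-- **`conj_c` is an involution of `H¹(N, M)` when `c² ∈ N`** (`conj_{c²} = id` by
`conjH1_of_mem`, `conj_{c·c} = conj_c ∘ conj_c` by `conjH1_mul`): the action of `G/N = {1, c̄}`.
[cite: SerreLocalFields1979, VII.§5 Prop. 3] -/
theorem conjH1_conjH1_of_mul_self_mem (hc2 : c * c ∈ N) (ξ : subgroupH1 N M) :
    conjH1 N M c (conjH1 N M c ξ) = ξ := by
  rw [← AddMonoidHom.comp_apply, ← conjH1_mul_holds N M c c, conjH1_of_mem_holds N M hc2,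
    AddMonoidHom.id_apply]

/-- With `G = N ⊔ N c`: a class of `H¹(N, M)` is fixed by EVERY `conj_g`, `g ∈ G`, iff it is
fixed by `conj_c` (elements of `N` act trivially, `conjH1_of_mem`; `conj_{nc} = conj_n ∘ conj_c`).
[cite: SerreLocalFields1979, VII.§5 Prop. 3] -/
theorem forall_conjH1_eq_iff_of_xor (hxor : ∀ b : G, Xor (b * c⁻¹ ∈ N) (b ∈ N))
    (ξ : subgroupH1 N M) : (∀ g : G, conjH1 N M g ξ = ξ) ↔ conjH1 N M c ξ = ξ := by
  refine ⟨fun h ↦ h c, fun hcξ g ↦ ?_⟩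
  rcases exists_eq_or_eq_mul hxor g with ⟨n, rfl⟩ | ⟨n, rfl⟩
  · rw [conjH1_of_mem_holds N M n.2, AddMonoidHom.id_apply]
  · rw [conjH1_mul_holds N M (n : G) c, AddMonoidHom.comp_apply, hcξ,
      conjH1_of_mem_holds N M n.2, AddMonoidHom.id_apply]

/-- **The `+` side, one conjugation**: with `G = N ⊔ N c`, `N` open normal, `M^{N} = 0`:
`ξ ∈ res H¹(G, M)` iff `conj_c ξ = ξ`. [cite: SerreGaloisCohomology1997, I §2.6 (b)] -/
theorem mem_range_resSubgroupH1_iff_conjH1_eq (hopen : IsOpen (N : Set G))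
    (hxor : ∀ b : G, Xor (b * c⁻¹ ∈ N) (b ∈ N))
    (hcont : ∀ m : M, Continuous fun g : G ↦ g • m)
    (hfix : FixedPoints.addSubgroup N M = ⊥) (ξ : subgroupH1 N M) :
    ξ ∈ (resSubgroupH1 N M).range ↔ conjH1 N M c ξ = ξ := by
  rw [mem_range_resSubgroupH1_iff_forall_conjH1_eq N hopen hcont hfix ξ,
    forall_conjH1_eq_iff_of_xor hxor ξ]

/-- **THE TWIST SIDE OF INFLATION–RESTRICTION (generic).** Let `N ≤ G` be open normal with
`G = N ⊔ N c`, `M`, `M'` discrete `G`-modules with continuous orbit maps, `ψ : M' ≃ M` additive,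
`N`-equivariant and ANTI-equivariant at `c` (`ψ (c m') = −c ψ(m')`: `M' = M ⊗ χ` for the character
`χ` of `G/N`), and `M^{N} = 0`. Then a class `ξ ∈ H¹(N, M)` lies in the image of
`ψ_* ∘ res' : H¹(G, M') → H¹(N, M') ≅ H¹(N, M)` iff it is ANTI-invariant: `conj_c ξ = −ξ`.
(`⟹`: `ψ_* c_* = −c_* ψ_*` (`h1Equiv_conjH1_neg`) and `c_*` fixes restricted classes; `⟸`:
`ξ' = ψ_*⁻¹ ξ` is `conj_c`-fixed, hence `conj_g`-fixed for all `g`, hence restricted from `G` by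
the image form of inflation–restriction for `M'`, whose `N`-fixed points vanish with those of `M`.)
For `G = Γ_ℚ ⊃ N = Γ_K`, `M = E[p^∞]`, `M' = E^{(c)}[p^∞]`:
**`H¹(ℚ, E^{(c)}[p^∞]) ≅ H¹(K, E[p^∞])^{τ = −1}`**.
[cite: Dokchitser2013ParityNotes, §4, proof of the Theorem "[Squarity, NekIV, Kurast]"]
[cite: SerreGaloisCohomology1997, I §2.6 (b)] -/
theorem exists_h1Equiv_resSubgroupH1_eq_iff (hopen : IsOpen (N : Set G))
    (hxor : ∀ b : G, Xor (b * c⁻¹ ∈ N) (b ∈ N))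
    (hcont' : ∀ m' : M', Continuous fun g : G ↦ g • m')
    (ψ : M' ≃+ M) (hψ : ∀ (n : N) (m' : M'), ψ (n • m') = n • ψ m')
    (hψc : ∀ m' : M', ψ (c • m') = -(c • ψ m'))
    (hfix : FixedPoints.addSubgroup N M = ⊥) (ξ : subgroupH1 N M) :
    (∃ η' : discreteH1 G M', h1Equiv ψ hψ (resSubgroupH1 N M' η') = ξ) ↔
      conjH1 N M c ξ = -ξ := by
  have hfix' : FixedPoints.addSubgroup N M' = ⊥ :=
    fixedPoints_eq_bot_of_equivariant_equiv ψ hψ hfix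
  constructor
  · rintro ⟨η', rfl⟩
    have h := h1Equiv_conjH1_neg ψ hψ hψc (resSubgroupH1 N M' η')
    rw [conjH1_resSubgroupH1 N hcont' c η'] at h
    exact (neg_eq_iff_eq_neg.mpr h).symm
  · intro hξ
    set ξ' := (h1Equiv ψ hψ).symm ξ with hξ'def
    have hξξ' : h1Equiv ψ hψ ξ' = ξ := (h1Equiv ψ hψ).apply_symm_apply ξ
    have hc' : conjH1 N M' c ξ' = ξ' := by
      apply (h1Equiv ψ hψ).injective
      rw [h1Equiv_conjH1_neg ψ hψ hψc, hξξ', hξ, neg_neg]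
    obtain ⟨η', hη'⟩ := (mem_range_resSubgroupH1_iff_forall_conjH1_eq N hopen hcont' hfix' ξ').2
      ((forall_conjH1_eq_iff_of_xor hxor ξ').2 hc')
    exact ⟨η', by rw [hη', hξξ']⟩

/-- **`ψ_* ∘ res' : H¹(G, M') → H¹(N, M)` is injective** when `M^{N} = 0` (`N` normal): the
composite of the injective restriction for `M'` (`M'^{N} = 0` by transport) and the isomorphism
`ψ_*`. [cite: SerreGaloisCohomology1997, I §2.6 (inflation–restriction)] -/
theorem h1Equiv_resSubgroupH1_injective (hcont' : ∀ m' : M', Continuous fun g : G ↦ g • m')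
    (ψ : M' ≃+ M) (hψ : ∀ (n : N) (m' : M'), ψ (n • m') = n • ψ m')
    (hfix : FixedPoints.addSubgroup N M = ⊥) :
    Function.Injective fun η' : discreteH1 G M' ↦ h1Equiv ψ hψ (resSubgroupH1 N M' η') :=
  (h1Equiv ψ hψ).injective.comp (resSubgroupH1_injective_of_fixedPoints_eq_bot N hcont'
    (fixedPoints_eq_bot_of_equivariant_equiv ψ hψ hfix))

/-- **Symmetrisation lands in `res H¹(G, M)`**: for every `ξ ∈ H¹(N, M)`, `ξ + conj_c ξ` is a
restriction from `G` (it is `conj_c`-fixed, `conj_c² = id`). With `M^{N} = 0` this is the SHARP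
form of `res ∘ cor = 1 + c_*`. [cite: SerreGaloisCohomology1997, I §2.6 (b)] -/
theorem add_conjH1_mem_range_resSubgroupH1 (hopen : IsOpen (N : Set G))
    (hxor : ∀ b : G, Xor (b * c⁻¹ ∈ N) (b ∈ N))
    (hcont : ∀ m : M, Continuous fun g : G ↦ g • m)
    (hfix : FixedPoints.addSubgroup N M = ⊥) (ξ : subgroupH1 N M) :
    ξ + conjH1 N M c ξ ∈ (resSubgroupH1 N M).range := by
  rw [mem_range_resSubgroupH1_iff_conjH1_eq hopen hxor hcont hfix, map_add,
    conjH1_conjH1_of_mul_self_mem (mul_self_mem_of_xor hxor), add_comm]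

/-- **Antisymmetrisation lands in `ψ_* res' H¹(G, M')`**: for every `ξ ∈ H¹(N, M)`,
`ξ − conj_c ξ` comes from the twist `H¹(G, M')` (it is `conj_c`-ANTI-invariant).
[cite: Dokchitser2013ParityNotes, §4, proof of the Theorem "[Squarity, NekIV, Kurast]"] -/
theorem exists_h1Equiv_resSubgroupH1_eq_sub_conjH1 (hopen : IsOpen (N : Set G))
    (hxor : ∀ b : G, Xor (b * c⁻¹ ∈ N) (b ∈ N))
    (hcont' : ∀ m' : M', Continuous fun g : G ↦ g • m')
    (ψ : M' ≃+ M) (hψ : ∀ (n : N) (m' : M'), ψ (n • m') = n • ψ m')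
    (hψc : ∀ m' : M', ψ (c • m') = -(c • ψ m'))
    (hfix : FixedPoints.addSubgroup N M = ⊥) (ξ : subgroupH1 N M) :
    ∃ η' : discreteH1 G M', h1Equiv ψ hψ (resSubgroupH1 N M' η') = ξ - conjH1 N M c ξ := by
  rw [exists_h1Equiv_resSubgroupH1_eq_iff hopen hxor hcont' ψ hψ hψc hfix, map_sub,
    conjH1_conjH1_of_mul_self_mem (mul_self_mem_of_xor hxor), neg_sub]

/-- **SHARP cokernel: `2 · H¹(N, M) ⊆ res H¹(G, M) + ψ_* res' H¹(G, M')`** when `M^{N} = 0`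
(`2ξ = (ξ + cξ) + (ξ − cξ)`). The tree's generic `IndexTwoDecompositionData.pow_nsmul_mem_range_decompMap`
gives `2^{a+1}` with the Selmer defect `a`; on all of `H¹` and under `M^{N} = 0` the exponent is `1`.
[cite: DokchitserDokchitserAnnals2010, Lemma 4.14 (proof)] -/
theorem two_nsmul_mem_sup_range (hopen : IsOpen (N : Set G))
    (hxor : ∀ b : G, Xor (b * c⁻¹ ∈ N) (b ∈ N))
    (hcont : ∀ m : M, Continuous fun g : G ↦ g • m)
    (hcont' : ∀ m' : M', Continuous fun g : G ↦ g • m')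
    (ψ : M' ≃+ M) (hψ : ∀ (n : N) (m' : M'), ψ (n • m') = n • ψ m')
    (hψc : ∀ m' : M', ψ (c • m') = -(c • ψ m'))
    (hfix : FixedPoints.addSubgroup N M = ⊥) (ξ : subgroupH1 N M) :
    ∃ (η : discreteH1 G M) (η' : discreteH1 G M'),
      resSubgroupH1 N M η + h1Equiv ψ hψ (resSubgroupH1 N M' η') = 2 • ξ := by
  obtain ⟨η, hη⟩ := add_conjH1_mem_range_resSubgroupH1 hopen hxor hcont hfix ξ
  obtain ⟨η', hη'⟩ := exists_h1Equiv_resSubgroupH1_eq_sub_conjH1 hopen hxor hcont' ψ hψ hψc hfix ξ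
  exact ⟨η, η', by rw [hη, hη', two_nsmul]; abel⟩

/-- **SHARP kernel: `res η + ψ_* res' η' = 0 ⟹ 2η = 0 ∧ 2η' = 0`** when `M^{N} = 0`
(`res η` is `conj_c`-fixed and `= −ψ_* res' η'` is anti-fixed, so `2 res η = 0 = 2 ψ_* res' η'`,
and both `res`, `ψ_* res'` are injective). The generic exponent (Selmer version,
`IndexTwoDecompositionData.nsmul_eq_zero_of_decompMap_eq_zero`) is `4`.
[cite: DokchitserDokchitserAnnals2010, Lemma 4.14 (proof)] -/
theorem two_nsmul_eq_zero_of_add_eq_zero (hopen : IsOpen (N : Set G))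
    (hxor : ∀ b : G, Xor (b * c⁻¹ ∈ N) (b ∈ N))
    (hcont : ∀ m : M, Continuous fun g : G ↦ g • m)
    (hcont' : ∀ m' : M', Continuous fun g : G ↦ g • m')
    (ψ : M' ≃+ M) (hψ : ∀ (n : N) (m' : M'), ψ (n • m') = n • ψ m')
    (hψc : ∀ m' : M', ψ (c • m') = -(c • ψ m'))
    (hfix : FixedPoints.addSubgroup N M = ⊥) (η : discreteH1 G M) (η' : discreteH1 G M')
    (h0 : resSubgroupH1 N M η + h1Equiv ψ hψ (resSubgroupH1 N M' η') = 0) :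
    2 • η = 0 ∧ 2 • η' = 0 := by
  have hplus : conjH1 N M c (resSubgroupH1 N M η) = resSubgroupH1 N M η :=
    conjH1_resSubgroupH1 N hcont c η
  have hminus : conjH1 N M c (h1Equiv ψ hψ (resSubgroupH1 N M' η')) =
      -h1Equiv ψ hψ (resSubgroupH1 N M' η') :=
    (exists_h1Equiv_resSubgroupH1_eq_iff hopen hxor hcont' ψ hψ hψc hfix _).1 ⟨η', rfl⟩
  have hab : resSubgroupH1 N M η = -h1Equiv ψ hψ (resSubgroupH1 N M' η') :=
    eq_neg_of_add_eq_zero_left h0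
  -- `res η = conj_c (res η) = conj_c (−ψ_* res' η') = ψ_* res' η'`
  have hab' : resSubgroupH1 N M η = h1Equiv ψ hψ (resSubgroupH1 N M' η') := by
    rw [← hplus, hab, map_neg, hminus, neg_neg]
  have h2a : 2 • resSubgroupH1 N M η = 0 := by
    rw [two_nsmul]
    nth_rewrite 2 [hab']
    exact h0
  have h2b : 2 • h1Equiv ψ hψ (resSubgroupH1 N M' η') = 0 := by
    have h : 2 • (resSubgroupH1 N M η + h1Equiv ψ hψ (resSubgroupH1 N M' η')) = 0 := by
      rw [h0, nsmul_zero]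
    rwa [nsmul_add, h2a, zero_add] at h
  refine ⟨resSubgroupH1_injective_of_fixedPoints_eq_bot N hcont hfix ?_,
    h1Equiv_resSubgroupH1_injective hcont' ψ hψ hfix ?_⟩
  · rw [map_nsmul, h2a, map_zero]
  · change h1Equiv ψ hψ (resSubgroupH1 N M' (2 • η')) = h1Equiv ψ hψ (resSubgroupH1 N M' 0)
    rw [map_nsmul, map_nsmul, h2b, map_zero, map_zero]

end Twist

end Summit.BirchSwinnertonDyer.BirchSwinnertonDyer.Theorems.GenusExact.TwistInfRes

end
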